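import Summits.AtomisticToContinuum.Crystallization.Theorems.FluxTubeKeplerFloorGivesLayered
import Summits.AtomisticToContinuum.Crystallization.Theorems.FluxTubeKeplerFluxCellKeplerSingleScale
import Summits.AtomisticToContinuum.Crystallization.Theorems.ChessboardParticlePlanesPeriodicWindowsIffCrystallization
import Summits.AtomisticToContinuum.Crystallization.Theorems.FluxTubeKeplerKeplerEnergyFloor
import Summits.AtomisticToContinuum.Crystallization.Theorems.BrittleRungDescentSoftLocalHales
import Summits.AtomisticToContinuum.Crystallization.Theorems.BrittleRungDescentSoftLayerPropagation

/-!
# Line `KissingBlindRung` (soft-kissing ladder) — skeleton for the forward rung over `FluxTubeKepler.FloorGivesLayered`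
(crux dir `FluxCellKepler`, stmt-AtomisticToContinuum-15221; fwd-rung G1 gen 16, seed g1-AtomisticToContinuum-15223)

FLOOR (proved, `FluxTubeKeplerFloorGivesLayered.FloorGivesLayered_proof`): for every periodic `P₀`, the energy
floor `N·e(P₀) ≤ E(x)` on Lennard-Jones ground states together with the defect BUDGET
`c(R,η) · #{(R,η)-non-layered sites} ≤ E(x) − N·e(P₀)` — a Kepler-type certificate that prices EVERY site whose
`R`-ball is not two-way `η`-matched with a relaxed Barlow template — forces layered windows, hence (proved
`PeriodicGivenLayered`) periodic windows, along every ground-state sequence.  Its proof is potential-free AND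
geometry-free: `o(N)` counting (`eventually_exists_not_bad`), Bolzano–Weierstrass on the spacing, dilation
covariance; it never infers order from anything — it only copies the template handed to it by a good site.

THE GRADED FAMILY `KissRung k` (ONE move — one hypothesis weakened: the SET OF PRICED SITES shrinks from
"`(R,η)`-non-layered" to "`(R,η)`-non-layered AND without a softly twelve-kissed `kR`-ball"):
* `SoftKissed a η x j` — site `j` is SOFTLY TWELVE-KISSED at scale `a`, tolerance `η`: every other particle is at
  distance `≥ a(1−η)`, each is either `≤ a(1+η)` or `≥ (63/50)·a` away (the Hales gap), and exactly twelve are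
  `≤ a(1+η)` — verbatim the a.e. hypothesis of `BrittleRungDescent.LJBondSpread` / `LJBarlowRigidity` with the
  fixed tolerance `1/400` replaced by the budget's `η`; a purely radial, rotation-free, first-shell datum
  (a distance list), no template, no registry, no orientation;
* `KissedBall k R η x i` — `k ≥ 1` and, for one spacing `a ∈ [47/50, 1]` (the floor's box), EVERY particle within
  `k·R` of `x i` is softly twelve-kissed at `(a, η)`; `KissedBall 0 := False`;
* `KissBudget k P₀` prices only the sites that are `(R,η)`-non-layered AND have no kissed `kR`-ball; `KissRung k`:
  FLOOR + `KissBudget k` force periodic windows along every ground-state sequence;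
* `KissRung 0` is the floor (`kissRung_zero`); `KissRung 1 → KissRung k → KissRung 0` for `k ≥ 1`
  (`kissRung_of_kissRung_one`, `kissRung_zero_of_kissRung`: the dial only removes priced sites, and a larger kissed
  ball contains the smaller); every member is a consequence of the sub-problem (`kissRung_of_crystallization`, on
  path, via the landed `periodicWindows_of_crystallization`);
* deciding rung `KissingBlindRung := KissRung 1` (the strongest member, `k₀ + 1 = 1`) — "a Kepler certificate that
  is BLIND to every region which is merely softly twelve-kissed (at any spacing in the box, at the certificate's own
  tolerance) still forces crystallization of the Lennard-Jones ground states".  The floor's counting cannot reach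
  it: an un-priced site is now either layered-good OR kissed-ball-good, and the floor's selection
  (`eventually_exists_not_bad`) may hand the limit step a site that carries NO template at all — only coordination
  numbers and a gap.  The new input is exactly the kissing-configuration RIGIDITY the floor never uses: Fejes Tóth's
  twelve-sphere classification in Hales's 2012 form (every shell in the class `𝒱` is the FCC or the HCP kissing
  pattern; in the tree as the PROVED `BrittleRungDescent.SoftLocalHales`, `Theorems.SoftLocalHales_proof`, at some
  tolerance `η₀ > 0`) and the Hales–DSP layer propagation (PROVED `BrittleRungDescent.SoftLayerPropagation`,
  `Theorems.softLayerPropagation`: a softly kissed AND FCC/HCP-graphed `R`-ball is one-way `δ`-close to an ideal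
  Barlow stacking on the `R/2`-ball).  Both live at SMALL tolerance — and the budget, quantified over ALL `η > 0`,
  lets the proof sit below `η₀` (this is what the fixed-tolerance kissing cruxes of other routes cannot do:
  `EffectiveLocalHales` at `1/100` is refuted by the decahedral shell, `DecahedralSoftShell`, `η⋆ ≈ 0.0067`).

Stubs (the only `sorry`s): `stub_barlowOfKissedBall` (transport of the two proved kernels to finite configurations
at spacing `a`: a kissed `R`-ball is one-way `δ`-matched to a rigid ideal Barlow stacking of spacing `a` on the
`R/4`-ball, for `η ≤ η₁(R,δ)`), `stub_layeredOfBarlowBall` (saturation: one-way + exact twelve-coordination ⇒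
two-way on the `R/8`-ball, and the re-centred ideal stacking is a member of the floor's layered family with
`z m = m·a√(2/3)`, gap `0.8165·a ∈ [0.78a, 0.85a]`); composition `KissingBlindRung_of` is sorry-free (restore the
floor's budget at scale `(R,η)` from the kissing-blind budget at the finer scale `(max 8R R₀, min η η₁ η₂)`, then the
seed `FloorGivesLayered_proof` + proved `PeriodicGivenLayered`).
-/

noncomputable section

namespace Summit.AtomisticToContinuum.Crystallization.Cruxes.FluxCellKepler.KissLadder

open scoped BigOperators Classical
open Filter Topology
open Literature.MathematicalPhysics.StatisticalMechanics
open Summit.AtomisticToContinuum.Crystallization.Theorems.FluxCellKeplerSingleScale (LayeredGood layeredGood_mono)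
open Summit.AtomisticToContinuum.Crystallization.Theorems.ChargedEnergyGapNegative (eStar)

local notation "E3" => EuclideanSpace ℝ (Fin 3)

/-! ## The objects of the ladder: soft twelve-kissing and kissed balls -/

/-- **SOFTLY TWELVE-KISSED** at scale `a` and tolerance `η`: every other particle of the configuration is at distance
`≥ a(1−η)` from `x j`; each is either within `a(1+η)` or beyond the Hales gap `(63/50)·a`; and exactly twelve are
within `a(1+η)`.  Verbatim the per-site predicate of `BrittleRungDescent.LJBondSpread` with `1/400 ↦ η`
(Hales 2012, Lemma 2: the class `𝒱`; soft form). -/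
def SoftKissed (a η : ℝ) {N : ℕ} (x : Fin N → E3) (j : Fin N) : Prop :=
  (∀ l : Fin N, l ≠ j → a * (1 - η) ≤ dist (x j) (x l) ∧
      (dist (x j) (x l) ≤ a * (1 + η) ∨ 63 / 50 * a ≤ dist (x j) (x l))) ∧
    Nat.card {l : Fin N // l ≠ j ∧ dist (x j) (x l) ≤ a * (1 + η)} = 12

/-- **KISSED BALL of radius `k·R`** (`k ≥ 1`; `KissedBall 0 := False`): for ONE spacing `a` in the floor's box
`[47/50, 1]`, every particle within `k·R` of `x i` (the centre included) is softly twelve-kissed at `(a, η)`.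
No template, no orientation, no registry: a radial first-shell datum at every particle of the ball. -/
def KissedBall (k : ℕ) (R η : ℝ) {N : ℕ} (x : Fin N → E3) (i : Fin N) : Prop :=
  0 < k ∧ ∃ a : ℝ, 47 / 50 ≤ a ∧ a ≤ 1 ∧ ∀ j : Fin N, dist (x j) (x i) ≤ (k : ℝ) * R → SoftKissed a η x j

/-! ## The rung family -/

/-- FLOOR(P₀): `N · e(P₀) ≤ E(x)` for every Lennard-Jones ground state `x` of every size `N`
(verbatim the first hypothesis of `FluxTubeKepler.FloorGivesLayered`). -/
def Floor (P₀ : PeriodicConfiguration 3) : Prop :=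
  ∀ (N : ℕ) (x : Fin N → E3), IsGroundState lennardJones x →
    (N : ℝ) * P₀.energyPerParticle lennardJones ≤ interactionEnergy lennardJones x

/-- KISSING-BLIND BUDGET with ball factor `k`: for every radius `R > 0` and tolerance `η > 0` some `c > 0` prices the
sites of every Lennard-Jones ground state that are `(R,η)`-non-layered AND have no kissed `kR`-ball at tolerance `η`,
against the excess energy over `N · e(P₀)` (`k = 0`: the floor's budget, every non-layered site priced; quantifier
order `∀ R η ∃ c` of the crux kept — Disproof §5: no `c` uniform in `R`, by the boundary witness, which is kissed
nowhere near the surface and so applies verbatim to this budget). -/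
def KissBudget (k : ℕ) (P₀ : PeriodicConfiguration 3) : Prop :=
  ∀ R η : ℝ, 0 < R → 0 < η → ∃ c : ℝ, 0 < c ∧
    ∀ (N : ℕ) (x : Fin N → E3), IsGroundState lennardJones x →
      c * (Nat.card {i : Fin N // ¬ LayeredGood R η x i ∧ ¬ KissedBall k R η x i} : ℝ) ≤
        interactionEnergy lennardJones x - (N : ℝ) * P₀.energyPerParticle lennardJones

/-- Periodic windows at every scale along the sequence `x` (ONE periodic `P`, translations only) —
verbatim the conclusion of `FluxTubeKepler.PeriodicWindows` / `FluxTubeKepler.PeriodicGivenLayered`. -/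
def HasPeriodicWindows (x : (N : ℕ) → (Fin N → E3)) : Prop :=
  ∃ P : PeriodicConfiguration 3, ∀ R ε : ℝ, 0 < ε → ∃ᶠ N in atTop, ∃ t : E3,
    (∀ q ∈ P.points, ‖q‖ ≤ R → ∃ i : Fin N, dist (x N i + t) q ≤ ε) ∧
    (∀ i : Fin N, ‖x N i + t‖ ≤ R → ∃ q ∈ P.points, dist (x N i + t) q ≤ ε)

/-- **The graded family.** `KissRung k`: FLOOR and the kissing-blind budget with ball factor `k` force periodic
windows along every Lennard-Jones ground-state sequence. -/
def KissRung (k : ℕ) : Prop :=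
  ∀ P₀ : PeriodicConfiguration 3, Floor P₀ → KissBudget k P₀ →
    ∀ x : (N : ℕ) → (Fin N → E3), (∀ N, IsGroundState lennardJones (x N)) → HasPeriodicWindows x

/-- **Deciding rung** (`k₀ + 1 = 1`, the strongest member): a certificate blind to every softly twelve-kissed
`R`-ball still forces crystallization of the ground states. -/
def KissingBlindRung : Prop := KissRung 1

/-! ## Counting helpers -/

theorem natCard_mono {N : ℕ} {p q : Fin N → Prop} (h : ∀ i, p i → q i) :
    Nat.card {i // p i} ≤ Nat.card {i // q i} := by
  rw [Nat.card_eq_fintype_card, Nat.card_eq_fintype_card]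
  exact Fintype.card_subtype_mono _ _ h

/-- `LayeredGood` is monotone in the tolerance. [folklore] -/
theorem layeredGood_tol {R η η' : ℝ} (hη : η' ≤ η) {N : ℕ} (x : Fin N → E3) (i : Fin N) :
    LayeredGood R η' x i → LayeredGood R η x i := by
  rintro ⟨a, ha₁, ha₂, A, s, z, hs, hz, h₁, h₂⟩
  refine ⟨a, ha₁, ha₂, A, s, z, hs, hz, ?_, ?_⟩
  · intro p hp hpR
    obtain ⟨j, hj⟩ := h₁ p hp hpR
    exact ⟨j, hj.trans hη⟩
  · intro j hj
    obtain ⟨p, hp, hjp⟩ := h₂ j hj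
    exact ⟨p, hp, hjp.trans hη⟩

/-! ## F3 — the family specialises to the proved floor -/

/-- Ball factor `0` exempts nothing: `KissedBall 0` is `False`. -/
@[simp] theorem not_kissedBall_zero (R η : ℝ) {N : ℕ} (x : Fin N → E3) (i : Fin N) : ¬ KissedBall 0 R η x i :=
  fun h => (lt_irrefl 0 h.1).elim

/-- At ball factor `0` the kissing-blind budget IS the floor's budget. -/
theorem kissBudget_zero_iff (P₀ : PeriodicConfiguration 3) :
    KissBudget 0 P₀ ↔
      ∀ R η : ℝ, 0 < R → 0 < η → ∃ c : ℝ, 0 < c ∧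
        ∀ (N : ℕ) (x : Fin N → E3), IsGroundState lennardJones x →
          c * (Nat.card {i : Fin N // ¬ LayeredGood R η x i} : ℝ) ≤
            interactionEnergy lennardJones x - (N : ℝ) * P₀.energyPerParticle lennardJones := by
  simp only [KissBudget, not_kissedBall_zero, not_false_eq_true, and_true]

/-- `KissRung 0` is the floor: the seed theorem followed by the proved `PeriodicGivenLayered`. -/
theorem kissRung_zero : KissRung 0 := fun P₀ hF hB x hx =>
  Theses.FluxTubeKepler.PeriodicGivenLayered_holds x hx
    (Theorems.FluxTubeKeplerFloorGivesLayered.FloorGivesLayered_proof P₀ hF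
      ((kissBudget_zero_iff P₀).1 hB) x hx)

/-! ## Dial: `KissRung 1 → KissRung k → KissRung 0` (`k ≥ 1`) -/

/-- The floor's budget prices a superset: `KissBudget 0 P₀ → KissBudget k P₀`. -/
theorem kissBudget_of_zero (k : ℕ) (P₀ : PeriodicConfiguration 3) : KissBudget 0 P₀ → KissBudget k P₀ := by
  intro hB R η hR hη
  obtain ⟨c, hc, hcB⟩ := hB R η hR hη
  refine ⟨c, hc, fun N x hx => le_trans ?_ (hcB N x hx)⟩
  have hle : Nat.card {i : Fin N // ¬ LayeredGood R η x i ∧ ¬ KissedBall k R η x i} ≤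
      Nat.card {i : Fin N // ¬ LayeredGood R η x i ∧ ¬ KissedBall 0 R η x i} :=
    natCard_mono fun i hi => ⟨hi.1, not_kissedBall_zero R η x i⟩
  exact mul_le_mul_of_nonneg_left (by exact_mod_cast hle) hc.le

/-- Every member implies the floor member (informational `specialises`). -/
theorem kissRung_zero_of_kissRung {k : ℕ} (h : KissRung k) : KissRung 0 :=
  fun P₀ hF hB x hx => h P₀ hF (kissBudget_of_zero k P₀ hB) x hx

/-- A larger kissed ball contains the unit one (`R ≥ 0`). -/
theorem kissedBall_one_of_kissedBall {k : ℕ} (hk : 0 < k) {R η : ℝ} (hR : 0 ≤ R) {N : ℕ} (x : Fin N → E3)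
    (i : Fin N) : KissedBall k R η x i → KissedBall 1 R η x i := by
  rintro ⟨-, a, ha₁, ha₂, h⟩
  refine ⟨Nat.one_pos, a, ha₁, ha₂, fun j hj => h j (hj.trans ?_)⟩
  have hk' : (1 : ℝ) ≤ (k : ℝ) := by exact_mod_cast hk
  simpa using mul_le_mul_of_nonneg_right hk' hR

/-- The budget with a larger ball factor prices a superset of the unit one's set: `KissBudget k → KissBudget 1`. -/
theorem kissBudget_one_of_kissBudget {k : ℕ} (hk : 0 < k) (P₀ : PeriodicConfiguration 3) :
    KissBudget k P₀ → KissBudget 1 P₀ := by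
  intro hB R η hR hη
  obtain ⟨c, hc, hcB⟩ := hB R η hR hη
  refine ⟨c, hc, fun N x hx => le_trans ?_ (hcB N x hx)⟩
  have hle : Nat.card {i : Fin N // ¬ LayeredGood R η x i ∧ ¬ KissedBall 1 R η x i} ≤
      Nat.card {i : Fin N // ¬ LayeredGood R η x i ∧ ¬ KissedBall k R η x i} :=
    natCard_mono fun i hi => ⟨hi.1, fun hK => hi.2 (kissedBall_one_of_kissedBall hk hR.le x i hK)⟩
  exact mul_le_mul_of_nonneg_left (by exact_mod_cast hle) hc.le

/-- The deciding member is the strongest: `KissRung 1 → KissRung k` for every `k ≥ 1`. -/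
theorem kissRung_of_kissRung_one {k : ℕ} (hk : 0 < k) (h : KissRung 1) : KissRung k :=
  fun P₀ hF hB x hx => h P₀ hF (kissBudget_one_of_kissBudget hk P₀ hB) x hx

/-! ## F4 — on-path lemmas: the sub-problem implies every member -/

/-- ON-PATH: `Crystallization → KissRung k` (landed hull-criterion converse `periodicWindows_of_crystallization`). -/
theorem kissRung_of_crystallization (k : ℕ) (h : _root_.Crystallization) : KissRung k :=
  fun _ _ _ x hx =>
    Theorems.ChessboardParticlePlanesPeriodicWindowsIffCrystallization.periodicWindows_of_crystallization h x hx

/-- ON-PATH for the deciding rung (tagged `aesop safe apply` so that the tribunal's fixed `S → C` portfolio finds it). -/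
@[aesop safe apply]
theorem KissingBlindRung_of_Crystallization (h : _root_.Crystallization) : KissingBlindRung :=
  kissRung_of_crystallization 1 h

/-! ## How the rung relieves the parent crux `FluxCellKepler` (documentation, sorry-free) -/

/-- The package the parent route would have to deliver for THIS rung: a periodic `P₀` with FLOOR and the
kissing-blind budget — a Kepler-type certificate that never prices a softly twelve-kissed region. -/
def KissKeplerFloor (k : ℕ) : Prop := ∃ P₀ : PeriodicConfiguration 3, Floor P₀ ∧ KissBudget k P₀

theorem windows_of_kissRung {k : ℕ} (h : KissRung k) (hK : KissKeplerFloor k) :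
    ∀ x : (N : ℕ) → (Fin N → E3), (∀ N, IsGroundState lennardJones (x N)) → HasPeriodicWindows x := by
  obtain ⟨P₀, hF, hB⟩ := hK
  exact fun x hx => h P₀ hF hB x hx

/-- The parent crux gives the package at every ball factor (proved `KeplerEnergyFloor` + minimal distance + the dial). -/
theorem kissKeplerFloor_of_fluxCellKepler (k : ℕ) (hK : Theses.FluxTubeKepler.FluxCellKepler) :
    KissKeplerFloor k := by
  obtain ⟨P₀, hF, hB⟩ := Theorems.keplerEnergyFloor_proof hK LennardJonesMinimalDistance_holds
  exact ⟨P₀, hF, kissBudget_of_zero k P₀ ((kissBudget_zero_iff P₀).2 fun R η hR hη => hB R η hR hη)⟩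

/-! ## The line: kissed ball ⇒ rigid ideal Barlow template (the proved kernels) ⇒ layered-good (saturation)

Two declared stubs; both potential-free. -/

/-- **Stub 1 — A KISSED BALL IS ONE-WAY BARLOW (transport of the two PROVED kernels).**  There is a radius `R₀`
(`7` will do) such that for every `R ≥ R₀` and `δ > 0` there is a tolerance `η₁ = η₁(R, δ) > 0` with: whenever
every particle within `R` of `x i` is softly twelve-kissed at `(a, η)`, `a ∈ [47/50, 1]`, `0 < η ≤ η₁`, there are
a Hägg word `s` and a rigid motion `g` such that every particle within `R/4` of `x i` is `δ`-close to
`g '' barlowStacking a (a√(2/3)) s` (the IDEAL stacking of spacing `a`).  Proof plan: rescale by `1/a`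
(`barlowPos` is linear in `(a, h)`, a homothety-conjugate of an isometry is an isometry); on `Set.range` of the
rescaled ball apply `Theorems.SoftLocalHales_proof` (Fejes Tóth–Hales: `η ≤ η₀` ⇒ FCC/HCP soft contact graph at
every particle whose `(1+η)`-neighbours are kissed, i.e. on the `(R/a − 2)`-ball; index counts = point counts there
because kissed sites are `a(1−η)`-separated) and then `Theorems.softLayerPropagation` at the FIXED radius `R − 3 ≥ 4`
(so that its `η(R − 3, δ)` is uniform in `a`), whose conclusion covers the `a(R−3)/2 ≥ R/4`-ball.
[cite: Hales2012, Lemma 2 and Theorem 3] -/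
theorem stub_barlowOfKissedBall :
    ∃ R₀ : ℝ, 0 < R₀ ∧ ∀ R : ℝ, R₀ ≤ R → ∀ δ : ℝ, 0 < δ → ∃ η₁ : ℝ, 0 < η₁ ∧ ∀ η : ℝ, 0 < η → η ≤ η₁ →
      ∀ (N : ℕ) (x : Fin N → E3) (i : Fin N) (a : ℝ), 47 / 50 ≤ a → a ≤ 1 →
        (∀ j : Fin N, dist (x j) (x i) ≤ R → SoftKissed a η x j) →
        ∃ (s : ℤ → ℤ) (g : E3 ≃ᵃⁱ[ℝ] E3), IsHaggSeq s ∧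
          ∀ j : Fin N, dist (x j) (x i) ≤ R / 4 →
            ∃ z ∈ barlowStacking a (a * Real.sqrt (2 / 3)) s, dist (x j) (g z) ≤ δ := by
  sorry

/-- **Stub 2 — ONE-WAY + TWELVE-COORDINATION ⇒ LAYERED-GOOD (saturation and family membership).**  There is a radius
`R₀` such that for every `R ≥ R₀` and target tolerance `η' > 0` there are `δ > 0` and `η₂ > 0` with: if every
particle within `R` of `x i` is softly twelve-kissed at `(a, η)`, `a ∈ [47/50,1]`, `0 < η ≤ η₂`, then ANY one-way
`δ`-match of the particles within `R/4` to a rigid ideal Barlow stacking `g '' barlowStacking a (a√(2/3)) s` (`s`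
Hägg) makes `i` `(R/8, η')`-layered-good.  Proof plan: (i) SATURATION — the match `j ↦ p_j` is injective
(`2δ < a(1−η)`); the twelve soft neighbours of a deep `j` land on twelve distinct template points at template
distance `∈ [a(1−η) − 2δ, a(1+η) + 2δ]`, hence exactly `a` (the next template distance is `a√2`): ALL twelve template
neighbours of `p_j` are matched; induct along template nearest-neighbour paths (graph distance `≤ 2·`euclidean`/a`)
to match every template point within `R/8 + δ` of `x i`; (ii) MEMBERSHIP — `g z = x i + (g zᵢ − x i) + A (z − zᵢ)`
with `A = g.linear`, `‖g zᵢ − x i‖ ≤ δ`, and `barlowStacking a h s − zᵢ` is EXACTLY the floor's family set for the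
shifted Hägg word `m ↦ s (m + kᵢ)` (`haggLabel` additivity, `haggLabel_succ`) with heights `z m = m · a√(2/3)`, gaps
`0.8165·a ∈ [39a/50, 17a/20]`; tolerances `2δ ≤ η'`. [folklore] -/
theorem stub_layeredOfBarlowBall :
    ∃ R₀ : ℝ, 0 < R₀ ∧ ∀ R : ℝ, R₀ ≤ R → ∀ η' : ℝ, 0 < η' → ∃ δ : ℝ, 0 < δ ∧ ∃ η₂ : ℝ, 0 < η₂ ∧
      ∀ η : ℝ, 0 < η → η ≤ η₂ → ∀ (N : ℕ) (x : Fin N → E3) (i : Fin N) (a : ℝ), 47 / 50 ≤ a → a ≤ 1 →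
        (∀ j : Fin N, dist (x j) (x i) ≤ R → SoftKissed a η x j) →
        ∀ (s : ℤ → ℤ) (g : E3 ≃ᵃⁱ[ℝ] E3), IsHaggSeq s →
          (∀ j : Fin N, dist (x j) (x i) ≤ R / 4 →
              ∃ z ∈ barlowStacking a (a * Real.sqrt (2 / 3)) s, dist (x j) (g z) ≤ δ) →
          LayeredGood (R / 8) η' x i := by
  sorry

/-! ### The stub statements as named propositions (verbatim) -/

/-- Statement of `stub_barlowOfKissedBall` (verbatim). [cite: Hales2012, Lemma 2 and Theorem 3] -/
def Sig.stub_barlowOfKissedBall : Prop :=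
    ∃ R₀ : ℝ, 0 < R₀ ∧ ∀ R : ℝ, R₀ ≤ R → ∀ δ : ℝ, 0 < δ → ∃ η₁ : ℝ, 0 < η₁ ∧ ∀ η : ℝ, 0 < η → η ≤ η₁ →
      ∀ (N : ℕ) (x : Fin N → E3) (i : Fin N) (a : ℝ), 47 / 50 ≤ a → a ≤ 1 →
        (∀ j : Fin N, dist (x j) (x i) ≤ R → SoftKissed a η x j) →
        ∃ (s : ℤ → ℤ) (g : E3 ≃ᵃⁱ[ℝ] E3), IsHaggSeq s ∧
          ∀ j : Fin N, dist (x j) (x i) ≤ R / 4 →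
            ∃ z ∈ barlowStacking a (a * Real.sqrt (2 / 3)) s, dist (x j) (g z) ≤ δ

/-- Statement of `stub_layeredOfBarlowBall` (verbatim). [folklore] -/
def Sig.stub_layeredOfBarlowBall : Prop :=
    ∃ R₀ : ℝ, 0 < R₀ ∧ ∀ R : ℝ, R₀ ≤ R → ∀ η' : ℝ, 0 < η' → ∃ δ : ℝ, 0 < δ ∧ ∃ η₂ : ℝ, 0 < η₂ ∧
      ∀ η : ℝ, 0 < η → η ≤ η₂ → ∀ (N : ℕ) (x : Fin N → E3) (i : Fin N) (a : ℝ), 47 / 50 ≤ a → a ≤ 1 →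
        (∀ j : Fin N, dist (x j) (x i) ≤ R → SoftKissed a η x j) →
        ∀ (s : ℤ → ℤ) (g : E3 ≃ᵃⁱ[ℝ] E3), IsHaggSeq s →
          (∀ j : Fin N, dist (x j) (x i) ≤ R / 4 →
              ∃ z ∈ barlowStacking a (a * Real.sqrt (2 / 3)) s, dist (x j) (g z) ≤ δ) →
          LayeredGood (R / 8) η' x i

/-! ### The kernel of the line: a kissed ball is layered-good (from the two stubs, sorry-free) -/

/-- **Kernel.** From the two stubs: there is `R⋆` such that for every `R ≥ R⋆` and `η' > 0` some `η⋆ ∈ (0, η']`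
makes every site with a kissed `R`-ball at tolerance `≤ η⋆` `(R/8, η')`-layered-good. -/
theorem layeredGood_of_kissedBall (h₁ : Sig.stub_barlowOfKissedBall) (h₂ : Sig.stub_layeredOfBarlowBall) :
    ∃ Rs : ℝ, 0 < Rs ∧ ∀ R : ℝ, Rs ≤ R → ∀ η' : ℝ, 0 < η' → ∃ ηs : ℝ, 0 < ηs ∧ ηs ≤ η' ∧
      ∀ η : ℝ, 0 < η → η ≤ ηs → ∀ (N : ℕ) (x : Fin N → E3) (i : Fin N),
        KissedBall 1 R η x i → LayeredGood (R / 8) η' x i := by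
  obtain ⟨R₁, hR₁, H₁⟩ := h₁
  obtain ⟨R₂, hR₂, H₂⟩ := h₂
  refine ⟨max R₁ R₂, lt_max_of_lt_left hR₁, fun R hR η' hη' => ?_⟩
  obtain ⟨δ, hδ, η₂, hη₂, K₂⟩ := H₂ R ((le_max_right _ _).trans hR) η' hη'
  obtain ⟨η₁, hη₁, K₁⟩ := H₁ R ((le_max_left _ _).trans hR) δ hδ
  refine ⟨min η' (min η₁ η₂), lt_min hη' (lt_min hη₁ hη₂), min_le_left _ _, fun η hη hηs N x i hK => ?_⟩
  obtain ⟨-, a, ha₁, ha₂, hkiss⟩ := hK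
  have hkiss' : ∀ j : Fin N, dist (x j) (x i) ≤ R → SoftKissed a η x j := fun j hj =>
    hkiss j (by simpa using hj)
  have hη₁' : η ≤ η₁ := hηs.trans ((min_le_right _ _).trans (min_le_left _ _))
  have hη₂' : η ≤ η₂ := hηs.trans ((min_le_right _ _).trans (min_le_right _ _))
  obtain ⟨s, g, hs, hmatch⟩ := K₁ η hη hη₁' N x i a ha₁ ha₂ hkiss'
  exact K₂ η hη hη₂' N x i a ha₁ ha₂ hkiss' s g hs hmatch

/-! ### The skeleton theorem: the rung BY NAME from the two stub statements (sorry-free) -/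

/-- **Assembly.** `stub_barlowOfKissedBall → stub_layeredOfBarlowBall → KissingBlindRung`.  Given FLOOR(P₀) and the
kissing-blind budget (ball factor `1`), the FLOOR's full budget holds at every scale `(R, η)`: at the finer scale
`(R', ηs) = (max 8R R⋆, η⋆(R', η))` every `(R,η)`-bad site is `(R',ηs)`-bad (monotonicity in radius and
tolerance) and has NO kissed `R'`-ball (else the kernel makes it `(R'/8, η)`-good, `R'/8 ≥ R`), so it is priced by
the kissing-blind budget with constant `c(R', ηs)`; then the seed `FloorGivesLayered_proof` + the proved
`PeriodicGivenLayered` give periodic windows. -/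
theorem KissingBlindRung_of (h₁ : Sig.stub_barlowOfKissedBall) (h₂ : Sig.stub_layeredOfBarlowBall) :
    KissingBlindRung := by
  obtain ⟨Rs, hRs, hker⟩ := layeredGood_of_kissedBall h₁ h₂
  intro P₀ hF hB x hx
  refine Theses.FluxTubeKepler.PeriodicGivenLayered_holds x hx
    (Theorems.FluxTubeKeplerFloorGivesLayered.FloorGivesLayered_proof P₀ hF ?_ x hx)
  intro R η hR hη
  set R' := max (8 * R) Rs with hR'def
  have hR' : 0 < R' := lt_max_of_lt_left (by linarith)
  have h8R : 8 * R ≤ R' := le_max_left _ _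
  obtain ⟨ηs, hηs, hηsle, hK⟩ := hker R' (le_max_right _ _) η hη
  obtain ⟨c, hc, hcB⟩ := hB R' ηs hR' hηs
  refine ⟨c, hc, fun N y hy => le_trans ?_ (hcB N y hy)⟩
  show _ * (Nat.card {i : Fin N // ¬ LayeredGood R η y i} : ℝ) ≤ _
  have hle : Nat.card {i : Fin N // ¬ LayeredGood R η y i} ≤
      Nat.card {i : Fin N // ¬ LayeredGood R' ηs y i ∧ ¬ KissedBall 1 R' ηs y i} := by
    refine natCard_mono (p := fun i => ¬ LayeredGood R η y i)
      (q := fun i => ¬ LayeredGood R' ηs y i ∧ ¬ KissedBall 1 R' ηs y i) fun i hi => ⟨?_, ?_⟩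
    · intro hg
      exact hi (layeredGood_tol hηsle y i (layeredGood_mono (by linarith) y i hg))
    · intro hKB
      have hg : LayeredGood (R' / 8) η y i := hK ηs hηs le_rfl N y i hKB
      exact hi (layeredGood_mono (by linarith) y i hg)
  exact mul_le_mul_of_nonneg_left (by exact_mod_cast hle) hc.le

/-- **The closed skeleton instance**: the rung by name from the two declared stubs (the only `sorry`s of this file
enter here). [conjecture] -/
theorem KissingBlindRung_skeleton : KissingBlindRung :=
  KissingBlindRung_of stub_barlowOfKissedBall stub_layeredOfBarlowBall

/-- Every member `KissRung k`, `k ≥ 1`, follows from the deciding one (so the whole non-floor family rides on the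
same two stubs). [conjecture] -/
theorem kissRung_skeleton {k : ℕ} (hk : 0 < k) : KissRung k :=
  kissRung_of_kissRung_one hk KissingBlindRung_skeleton

/-- Registrar alias (`ledger skeleton check --crux-decl …KissLadder.KissingBlindRung` expects `<Decl>_proof`): the
rung by name from the two stubs; identical to `KissingBlindRung_skeleton`. [conjecture] -/
theorem KissingBlindRung_proof : KissingBlindRung := KissingBlindRung_skeleton

end Summit.AtomisticToContinuum.Crystallization.Cruxes.FluxCellKepler.KissLadder

end
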